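import Summits.SmoothPoincare4.SmoothPoincare4.Theorems.CongruenceShadowsAgkCor6SufficiencyStubSeamFlowTube
import Summits.SmoothPoincare4.SmoothPoincare4.Theorems.CongruenceShadowsAgkCor6SufficiencyStubSeamFormLocal
import Summits.SmoothPoincare4.SmoothPoincare4.Theorems.CongruenceShadowsAgkCor6SufficiencyStubSeamFormTube

/-!
# Helpers for stub `stub_seamForm` of line `lp-by-sphere-system-surgery` (crux `AgkCor6Sufficiency`,
item stmt-SmoothPoincare4-10894, routes CongruenceShadows / GroupTrisection; lead reshape r5, A3):
the seam zone `N m`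

For seam `m` of a tri-normal form with presentations `G j` of unit form on the tube `T(20 r₀)`
of a tube structure, we build the open **seam zone** `N = Box ∪ Out` (`exists_seamZone`,
bundled in the registered helper stub `stub_seamFormZoneToolkit : SeamFormZoneToolkit`):
`Box = {x ∈ T(10 r₀) | p > r₀, |q| < r₀ / 2}` in the seam coordinates `(p, q)` of `m`, and
`Out` a thin open neighbourhood of the compact seam piece `H_m ∖ T(9 r₀)` inside a prescribed
open `Um`, inside the finitely many local neighbourhoods of `seamLocal`
(`…StubSeamFormLocal.lean`), outside `closure T(9 r₀)` and, near `closure T(10 r₀)`, inside the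
`Ot`-box.  On `N`: `σ = G_ref - 1` is regular, `{σ = 0} = H_m`, `S_ref = {σ ≤ 0}`,
`S_norm = {σ ≥ 0}` (wedge algebra in the box, `seamLocal` outside), `G_norm` is regular; `N ∩ T(10 r₀) = Box`;
the frontier of `N` off `T(10 r₀)` misses `{σ = 0}`; and the uniform threshold `η` of the local
no-critical-point estimate off `T(10 r₀)`.

## References

* A. Abrams, D. Gay, R. Kirby, *Group trisections and smooth 4-manifolds*, Geom. Topol. 22
  (2018), proof of Thm. 5. [AbramsGayKirby2018]
* D. Gay, R. Kirby, *Trisecting 4-manifolds*, Geom. Topol. 20 (2016), Def. 1. [GayKirby2016]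
-/

noncomputable section

-- the prescribed namespace `Summit.<P>.<Sub>.…` duplicates `SmoothPoincare4` (P = Sub)
set_option linter.dupNamespace false

open Set Function Filter Metric
open scoped Manifold ContDiff Topology

namespace Summit.SmoothPoincare4.SmoothPoincare4.Cruxes.AgkCor6Sufficiency.LpBySphereSystemSurgery

open Literature.Topology.FourManifolds

-- adapted from `exists_pos_le_finset` (…StubTubeStructure.lean)
/-- A positive lower bound for finitely many positive reals. -/
theorem exists_pos_le_of_finset {ι : Type} (t : Finset ι) (f : ι → ℝ) (hf : ∀ i ∈ t, 0 < f i) :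
    ∃ r : ℝ, 0 < r ∧ ∀ i ∈ t, r ≤ f i := by
  rcases t.eq_empty_or_nonempty with rfl | hne
  · exact ⟨1, one_pos, by simp⟩
  · exact ⟨t.inf' hne f, (Finset.lt_inf'_iff hne).2 hf, fun i hi => Finset.inf'_le f hi⟩

variable {X : Type} [TopologicalSpace X] [ChartedSpace (EuclideanSpace ℝ (Fin 4)) X]

/-- **The seam zone** (see the module docstring). [cite: AbramsGayKirby2018, proof of Thm. 5] -/
theorem exists_seamZone [T2Space X] [IsManifold (𝓡 4) ∞ X] [CompactSpace X]
    {S : Fin 3 → Set X} {u v : X → ℝ} {ρ : X → X} {U O : Set X} {c : Fin 3 → ℕ → ℕ}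
    (hT : TriNormalForm S 0 1 2 u v ρ U O c) {G : Fin 3 → X → ℝ}
    (hGs : ∀ j, ContMDiff (𝓡 4) 𝓘(ℝ, ℝ) ∞ (G j))
    (hG1 : ∀ j, ∀ p ∈ S j, p ∉ interior (S j) → G j p = 1)
    (hG2 : ∀ j, ∀ p ∈ interior (S j), G j p < 1)
    (hG3 : ∀ j, ∀ p ∈ S j, p ∉ interior (S j) → p ∉ (⋂ l, S l) →
      ¬ IsMCriticalPt (𝓡 4) (G j) p)
    (hhalf : ∀ j, ∀ p ∈ S j, p ∉ (⋂ l, S l) →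
      ∃ D : HalfSliceChart (𝓡 4) (S j), p ∈ D.Θ.source ∧ ∀ q ∈ D.Θ.source, q ∉ ⋂ l, S l)
    {Ot : Set X} {rt : ℝ} {tp : X → ℝ → ℝ → X}
    (hTS : TubeStructure (S 0) (⋂ l, S l) u v ρ O Ot rt tp) {r₀ : ℝ} (hr₀ : 0 < r₀)
    (hrt : 20 * r₀ ≤ rt)
    (hunit : ∀ j, ∀ x ∈ tubeSet Ot u v (20 * r₀), G j x = unitForm j (u x) (v x))
    (m : Fin 3) {Um : Set X} (hUmo : IsOpen Um)
    (hUm : ∀ x ∈ S (refIdx m) ∩ S (normIdx m), x ∉ tubeSet Ot u v (9 * r₀) → x ∈ Um) :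
    ∃ (N : Set X) (η : ℝ), IsOpen N ∧ 0 < η ∧
      (∀ x ∈ S (refIdx m) ∩ S (normIdx m), x ∉ tubeSet Ot u v (2 * r₀) → x ∈ N) ∧
      (∀ x ∈ tubeSet Ot u v (10 * r₀),
        x ∈ N ↔ r₀ < pCo m (u x) (v x) ∧ |qCo m (u x) (v x)| < r₀ / 2) ∧
      N ⊆ tubeSet Ot u v (10 * r₀) ∪ Um ∧
      (∀ x ∈ N, ¬ IsMCriticalPt (𝓡 4) (G (refIdx m)) x) ∧
      (∀ x ∈ N, ¬ IsMCriticalPt (𝓡 4) (G (normIdx m)) x) ∧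
      (∀ x ∈ N, G (refIdx m) x = 1 ↔ x ∈ S (refIdx m) ∩ S (normIdx m)) ∧
      (∀ x ∈ N, x ∈ S (refIdx m) ↔ G (refIdx m) x ≤ 1) ∧
      (∀ x ∈ N, x ∈ S (normIdx m) ↔ 1 ≤ G (refIdx m) x) ∧
      (∀ x ∈ N, x ∈ closure (tubeSet Ot u v (10 * r₀)) →
        x ∈ Ot ∧ r₀ < pCo m (u x) (v x) ∧ |qCo m (u x) (v x)| < r₀ / 2) ∧
      (∀ x ∈ closure N, x ∉ N → x ∉ tubeSet Ot u v (10 * r₀) → G (refIdx m) x ≠ 1) ∧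
      (∀ x ∈ closure N, x ∈ tubeSet Ot u v (10 * r₀) →
        r₀ ≤ pCo m (u x) (v x) ∧ |qCo m (u x) (v x)| ≤ r₀ / 2) ∧
      (∀ ψ : ℝ → ℝ, Differentiable ℝ ψ → (∀ t, 0 ≤ ψ t ∧ ψ t ≤ 1) →
        (∀ t, |t * deriv ψ t| ≤ η) → ∀ x ∈ N, x ∉ tubeSet Ot u v (10 * r₀) → ∀ f : X → ℝ,
          ContMDiff (𝓡 4) 𝓘(ℝ, ℝ) ∞ f →
          (f =ᶠ[𝓝 x] fun w => G (normIdx m) w + ψ (G (refIdx m) w - 1) *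
            (1 - (G (refIdx m) w - 1) - G (normIdx m) w)) →
          ¬ IsMCriticalPt (𝓡 4) f x) := by
  classical
  -- ### notation and basic facts
  have hfr := hT.frame
  have hu : Continuous u := hfr.contMDiff_u.continuous
  have hv : Continuous v := hfr.contMDiff_v.continuous
  have hpc := continuous_pCo_comp m hu hv
  have hqc := continuous_qCo_comp m hu hv
  have hOtU : Ot ⊆ U := hTS.subset_O.trans hfr.O_subset_U
  have hρF : ∀ x ∈ Ot, ρ x ∈ ⋂ l, S l := fun x hx => hfr.ρ_mem x (hTS.subset_O hx)
  have hTo : ∀ s, IsOpen (tubeSet Ot u v s) := isOpen_tubeSet hTS hfr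
  have hTmono : ∀ {a b : ℝ}, 0 ≤ a → a ≤ b → tubeSet Ot u v a ⊆ tubeSet Ot u v b :=
    fun ha hab => tubeSet_mono ha hab
  have hcl9 : closure (tubeSet Ot u v (9 * r₀)) ⊆ tubeSet Ot u v (10 * r₀) := fun x hx => by
    have h := closure_tubeSet_subset hTS hfr (s := 9 * r₀) (by linarith) (by linarith) hx
    exact ⟨h.1, by nlinarith [h.2]⟩
  have hcl10 : closure (tubeSet Ot u v (10 * r₀)) ⊆
      {x | x ∈ Ot ∧ u x ^ 2 + v x ^ 2 ≤ (10 * r₀) ^ 2} :=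
    closure_tubeSet_subset hTS hfr (by linarith) (by linarith)
  have hCT20 : ∀ x ∈ Ot, u x ^ 2 + v x ^ 2 ≤ (10 * r₀) ^ 2 → x ∈ tubeSet Ot u v (20 * r₀) :=
    fun x hx h => ⟨hx, by nlinarith⟩
  have h10_20 : tubeSet Ot u v (10 * r₀) ⊆ tubeSet Ot u v (20 * r₀) := hTmono (by linarith) (by linarith)
  -- unit forms on `T(20 r₀)`
  have hσ20 : ∀ x ∈ tubeSet Ot u v (20 * r₀),
      G (refIdx m) x - 1 = -2 * pCo m (u x) (v x) * qCo m (u x) (v x) := fun x hx => by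
    rw [hunit _ x hx]; exact unitForm_refIdx m (u x) (v x)
  have hGn20 : ∀ x ∈ tubeSet Ot u v (20 * r₀), G (normIdx m) x =
      1 + 2 * pCo m (u x) (v x) * qCo m (u x) (v x) - 2 * qCo m (u x) (v x) ^ 2 := fun x hx => by
    rw [hunit _ x hx]; exact unitForm_normIdx m (u x) (v x)
  -- the wedges
  have hseam : ∀ x ∈ Ot, x ∈ S (refIdx m) ∩ S (normIdx m) ↔
      qCo m (u x) (v x) = 0 ∧ 0 ≤ pCo m (u x) (v x) := fun x hx => mem_seam_iff hT m (hOtU hx)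
  -- the compact seam piece `K = H_m ∖ T(9 r₀)` and the central surface
  have hFT : ∀ {s : ℝ}, 0 < s → (⋂ l, S l) ⊆ tubeSet Ot u v s := by
    intro s hs x hx
    obtain ⟨hu0, hv0⟩ := (hfr.memF_iff x (hfr.F_subset_U hx)).1 hx
    exact ⟨hTS.F_subset hx, by rw [hu0, hv0]; simpa using pow_pos hs 2⟩
  set K : Set X := (S (refIdx m) ∩ S (normIdx m)) ∩ (tubeSet Ot u v (9 * r₀))ᶜ with hK
  have hKc : IsCompact K :=
    (((hT.isCompact _).inter_right (hT.isCompact _).isClosed)).inter_right (hTo _).isClosed_compl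
  -- ### the local analysis at the points of `K`
  have hloc : ∀ y : K, ∃ (V V' : Set X), IsOpen V ∧ IsOpen V' ∧ (y : X) ∈ V ∧ closure V ⊆ V' ∧
      ∃ η : ℝ, 0 < η ∧
      (∀ x ∈ V', ¬ IsMCriticalPt (𝓡 4) (G (refIdx m)) x) ∧
      (∀ x ∈ V', ¬ IsMCriticalPt (𝓡 4) (G (normIdx m)) x) ∧
      (∀ x ∈ V', G (refIdx m) x = 1 ↔ x ∈ S (refIdx m) ∩ S (normIdx m)) ∧
      (∀ x ∈ V', x ∈ S (refIdx m) ↔ G (refIdx m) x ≤ 1) ∧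
      (∀ x ∈ V', x ∈ S (normIdx m) ↔ 1 ≤ G (refIdx m) x) ∧
      (∀ ψ : ℝ → ℝ, Differentiable ℝ ψ → (∀ t, 0 ≤ ψ t ∧ ψ t ≤ 1) →
        (∀ t, |t * deriv ψ t| ≤ η) → ∀ x ∈ V', ∀ f : X → ℝ, ContMDiff (𝓡 4) 𝓘(ℝ, ℝ) ∞ f →
          (f =ᶠ[𝓝 x] fun w => G (normIdx m) w + ψ (G (refIdx m) w - 1) *
            (1 - (G (refIdx m) w - 1) - G (normIdx m) w)) →
          ¬ IsMCriticalPt (𝓡 4) f x) := by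
    rintro ⟨y, hyS, hy9⟩
    have hyF : y ∉ ⋂ l, S l := fun h => hy9 (hFT (by linarith) h)
    exact seamLocal hT.cover hT.isCompact hT.disjoint m (hGs _) (hGs _) (hG1 _) (hG2 _) (hG3 _)
      (hG1 _) (hG2 _) (hG3 _) (hhalf _) hyS hyF
  choose V V' hVo hV'o hyV hclV η hη hL5 hL5n hL6 hL7 hL8 hLM using hloc
  obtain ⟨t, ht⟩ := hKc.elim_finite_subcover V hVo (fun y hy => mem_iUnion.2 ⟨⟨y, hy⟩, hyV ⟨y, hy⟩⟩)
  obtain ⟨η₀, hη₀, hη₀le⟩ := exists_pos_le_of_finset t η (fun y _ => hη y)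
  set Vfin : Set X := ⋃ y ∈ t, V y with hVfin
  set V'fin : Set X := ⋃ y ∈ t, V' y with hV'fin
  have hVfino : IsOpen Vfin := isOpen_biUnion fun y _ => hVo y
  have hKV : K ⊆ Vfin := ht
  have hclVfin : closure Vfin ⊆ V'fin := by
    have h1 : Vfin ⊆ ⋃ y ∈ t, closure (V y) := iUnion₂_mono fun y _ => subset_closure
    have h2 : IsClosed (⋃ y ∈ t, closure (V y)) :=
      t.finite_toSet.isClosed_biUnion fun y _ => isClosed_closure
    refine (h2.closure_subset_iff.2 h1).trans (iUnion₂_mono fun y _ => hclV y)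
  have hVV' : Vfin ⊆ V'fin := subset_closure.trans hclVfin
  have hmemV' : ∀ x ∈ V'fin, ∃ y ∈ t, x ∈ V' y := fun x hx => by
    simpa only [hV'fin, mem_iUnion, exists_prop] using hx
  -- ### the zone
  set A : Set X := {x | x ∈ Ot ∧ r₀ < pCo m (u x) (v x) ∧ |qCo m (u x) (v x)| < r₀ / 2} ∪
    (closure (tubeSet Ot u v (10 * r₀)))ᶜ with hA
  set Box : Set X := {x | x ∈ tubeSet Ot u v (10 * r₀) ∧ r₀ < pCo m (u x) (v x) ∧
    |qCo m (u x) (v x)| < r₀ / 2} with hBox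
  set Out : Set X := A ∩ Vfin ∩ Um ∩ (closure (tubeSet Ot u v (9 * r₀)))ᶜ with hOut
  set N : Set X := Box ∪ Out with hN
  have hboxo' : IsOpen {x : X | r₀ < pCo m (u x) (v x) ∧ |qCo m (u x) (v x)| < r₀ / 2} :=
    (isOpen_lt continuous_const hpc).inter (isOpen_lt (continuous_abs.comp hqc) continuous_const)
  have hAo : IsOpen A := by
    refine IsOpen.union ?_ isClosed_closure.isOpen_compl
    have : {x | x ∈ Ot ∧ r₀ < pCo m (u x) (v x) ∧ |qCo m (u x) (v x)| < r₀ / 2} =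
        Ot ∩ {x : X | r₀ < pCo m (u x) (v x) ∧ |qCo m (u x) (v x)| < r₀ / 2} := rfl
    rw [this]; exact hTS.isOpen.inter hboxo'
  have hBoxo : IsOpen Box := by
    have : Box = tubeSet Ot u v (10 * r₀) ∩
        {x : X | r₀ < pCo m (u x) (v x) ∧ |qCo m (u x) (v x)| < r₀ / 2} := rfl
    rw [this]; exact (hTo _).inter hboxo'
  have hOuto : IsOpen Out := ((hAo.inter hVfino).inter hUmo).inter isClosed_closure.isOpen_compl
  have hNo : IsOpen N := hBoxo.union hOuto
  -- seam points off `T(10 r₀)` lie in `Out`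
  have hback : ∀ x ∈ S (refIdx m) ∩ S (normIdx m), x ∉ tubeSet Ot u v (10 * r₀) → x ∈ Out := by
    intro x hxS hx10
    have hx9 : x ∉ tubeSet Ot u v (9 * r₀) := fun h => hx10 (hTmono (by linarith) (by linarith) h)
    have hxK : x ∈ K := ⟨hxS, hx9⟩
    refine ⟨⟨⟨?_, hKV hxK⟩, hUm x hxS hx9⟩, fun h => hx10 (hcl9 h)⟩
    by_cases hxOt : x ∈ Ot
    · left
      obtain ⟨hq0, hp0⟩ := (hseam x hxOt).1 hxS
      have h100 : (10 * r₀) ^ 2 ≤ u x ^ 2 + v x ^ 2 := by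
        by_contra h; exact hx10 ⟨hxOt, not_le.1 h⟩
      have hle := normSq_le m (u x) (v x) hp0
      rw [hq0, abs_zero, add_zero] at hle
      refine ⟨hxOt, ?_, by rw [hq0, abs_zero]; linarith⟩
      nlinarith
    · right
      exact fun h => hxOt (hcl10 h).1
  -- ### the clauses
  have hP2 : ∀ x ∈ S (refIdx m) ∩ S (normIdx m), x ∉ tubeSet Ot u v (2 * r₀) → x ∈ N := by
    intro x hxS hx2
    by_cases hx10 : x ∈ tubeSet Ot u v (10 * r₀)
    · left
      obtain ⟨hq0, hp0⟩ := (hseam x hx10.1).1 hxS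
      have h4 : (2 * r₀) ^ 2 ≤ u x ^ 2 + v x ^ 2 := by
        by_contra h; exact hx2 ⟨hx10.1, not_le.1 h⟩
      have hle := normSq_le m (u x) (v x) hp0
      rw [hq0, abs_zero, add_zero] at hle
      refine ⟨hx10, ?_, by rw [hq0, abs_zero]; linarith⟩
      nlinarith
    · exact Or.inr (hback x hxS hx10)
  have hP3 : ∀ x ∈ tubeSet Ot u v (10 * r₀),
      x ∈ N ↔ r₀ < pCo m (u x) (v x) ∧ |qCo m (u x) (v x)| < r₀ / 2 := by
    intro x hx10
    constructor
    · rintro (hb | ho)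
      · exact hb.2
      · rcases ho.1.1.1 with h | h
        · exact h.2
        · exact absurd (subset_closure hx10) h
    · exact fun h => Or.inl ⟨hx10, h⟩
  have hP4 : N ⊆ tubeSet Ot u v (10 * r₀) ∪ Um := by
    rintro x (hb | ho)
    · exact Or.inl hb.1
    · exact Or.inr ho.1.2
  have hA1 : ∀ x ∈ N, x ∈ closure (tubeSet Ot u v (10 * r₀)) →
      x ∈ Ot ∧ r₀ < pCo m (u x) (v x) ∧ |qCo m (u x) (v x)| < r₀ / 2 := by
    rintro x (hb | ho) hcl
    · exact ⟨hb.1.1, hb.2⟩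
    · rcases ho.1.1.1 with h | h
      · exact h
      · exact absurd hcl h
  -- facts on the box
  have hboxfacts : ∀ x ∈ Box, (¬ IsMCriticalPt (𝓡 4) (G (refIdx m)) x) ∧
      (¬ IsMCriticalPt (𝓡 4) (G (normIdx m)) x) ∧
      (G (refIdx m) x = 1 ↔ x ∈ S (refIdx m) ∩ S (normIdx m)) ∧
      (x ∈ S (refIdx m) ↔ G (refIdx m) x ≤ 1) ∧ (x ∈ S (normIdx m) ↔ 1 ≤ G (refIdx m) x) := by
    rintro x ⟨hx10, hp, hq⟩
    have hxOt : x ∈ Ot := hx10.1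
    have hσ := hσ20 x (h10_20 hx10)
    have hp0 : 0 < pCo m (u x) (v x) := hr₀.trans hp
    have hq' := abs_lt.1 hq
    refine ⟨?_, ?_, ?_, ?_, ?_⟩
    · refine sigma_regular_tube hTS hρF m (hGs _) hxOt ?_ hp0.ne'
      filter_upwards [(hTo (20 * r₀)).mem_nhds (h10_20 hx10)] with y hy
      linarith [hσ20 y hy]
    · refine norm_regular_tube hTS hρF m (hGs _) hxOt ?_ (by linarith)
      filter_upwards [(hTo (20 * r₀)).mem_nhds (h10_20 hx10)] with y hy
      exact hGn20 y hy
    · rw [hseam x hxOt]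
      constructor
      · intro h1
        have h0 : -2 * pCo m (u x) (v x) * qCo m (u x) (v x) = 0 := by rw [← hσ, h1]; ring
        refine ⟨?_, hp0.le⟩
        rcases mul_eq_zero.1 h0 with h | h
        · exact absurd h (by nlinarith)
        · exact h
      · rintro ⟨hq0, -⟩
        have : G (refIdx m) x - 1 = 0 := by rw [hσ, hq0]; ring
        linarith
    · rw [mem_ref_iff hT m (hOtU hxOt)]
      constructor
      · rintro ⟨-, hq0⟩; nlinarith [mul_nonneg hp0.le hq0]
      · intro h
        refine ⟨hp0.le, ?_⟩
        by_contra hneg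
        have : 0 < -2 * pCo m (u x) (v x) * qCo m (u x) (v x) := by
          nlinarith [mul_neg_of_pos_of_neg hp0 (not_le.1 hneg)]
        linarith
    · rw [mem_norm_iff hT m (hOtU hxOt)]
      constructor
      · rintro ⟨hq0, -⟩; nlinarith [mul_nonpos_iff.2 (Or.inl ⟨hp0.le, hq0⟩)]
      · intro h
        have hq0 : qCo m (u x) (v x) ≤ 0 := by
          by_contra hpos
          have : -2 * pCo m (u x) (v x) * qCo m (u x) (v x) < 0 := by
            nlinarith [mul_pos hp0 (not_le.1 hpos)]
          linarith
        exact ⟨hq0, by linarith⟩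
  have hOutV' : ∀ x ∈ Out, ∃ y ∈ t, x ∈ V' y := fun x hx => hmemV' x (hVV' hx.1.1.2)
  have hP5 : ∀ x ∈ N, ¬ IsMCriticalPt (𝓡 4) (G (refIdx m)) x := by
    rintro x (hb | ho)
    · exact (hboxfacts x hb).1
    · obtain ⟨y, -, hy⟩ := hOutV' x ho; exact hL5 y x hy
  have hP5n : ∀ x ∈ N, ¬ IsMCriticalPt (𝓡 4) (G (normIdx m)) x := by
    rintro x (hb | ho)
    · exact (hboxfacts x hb).2.1
    · obtain ⟨y, -, hy⟩ := hOutV' x ho; exact hL5n y x hy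
  have hP6 : ∀ x ∈ N, G (refIdx m) x = 1 ↔ x ∈ S (refIdx m) ∩ S (normIdx m) := by
    rintro x (hb | ho)
    · exact (hboxfacts x hb).2.2.1
    · obtain ⟨y, -, hy⟩ := hOutV' x ho; exact hL6 y x hy
  have hP7 : ∀ x ∈ N, x ∈ S (refIdx m) ↔ G (refIdx m) x ≤ 1 := by
    rintro x (hb | ho)
    · exact (hboxfacts x hb).2.2.2.1
    · obtain ⟨y, -, hy⟩ := hOutV' x ho; exact hL7 y x hy
  have hP8 : ∀ x ∈ N, x ∈ S (normIdx m) ↔ 1 ≤ G (refIdx m) x := by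
    rintro x (hb | ho)
    · exact (hboxfacts x hb).2.2.2.2
    · obtain ⟨y, -, hy⟩ := hOutV' x ho; exact hL8 y x hy
  -- the closure of the box
  have hclBox : closure Box ⊆ {x | x ∈ Ot ∧ u x ^ 2 + v x ^ 2 ≤ (10 * r₀) ^ 2 ∧
      r₀ ≤ pCo m (u x) (v x) ∧ |qCo m (u x) (v x)| ≤ r₀ / 2} := by
    have h1 : Box ⊆ closure (tubeSet Ot u v (10 * r₀)) ∩
        {x | r₀ ≤ pCo m (u x) (v x) ∧ |qCo m (u x) (v x)| ≤ r₀ / 2} :=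
      fun x hx => ⟨subset_closure hx.1, hx.2.1.le, hx.2.2.le⟩
    have h2 : IsClosed (closure (tubeSet Ot u v (10 * r₀)) ∩
        {x | r₀ ≤ pCo m (u x) (v x) ∧ |qCo m (u x) (v x)| ≤ r₀ / 2}) :=
      isClosed_closure.inter ((isClosed_le continuous_const hpc).inter
        (isClosed_le (continuous_abs.comp hqc) continuous_const))
    intro x hx
    obtain ⟨hc, hp, hq⟩ := h2.closure_subset_iff.2 h1 hx
    exact ⟨(hcl10 hc).1, (hcl10 hc).2, hp, hq⟩
  have hA3 : ∀ x ∈ closure N, x ∈ tubeSet Ot u v (10 * r₀) →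
      r₀ ≤ pCo m (u x) (v x) ∧ |qCo m (u x) (v x)| ≤ r₀ / 2 := by
    intro x hx hx10
    have h1 : x ∈ closure (N ∩ tubeSet Ot u v (10 * r₀)) := (hTo _).closure_inter ⟨hx, hx10⟩
    have h2 : N ∩ tubeSet Ot u v (10 * r₀) ⊆ Box := fun y hy => ⟨hy.2, (hP3 y hy.2).1 hy.1⟩
    have h3 := hclBox (closure_mono h2 h1)
    exact ⟨h3.2.2.1, h3.2.2.2⟩
  have hA2 : ∀ x ∈ closure N, x ∉ N → x ∉ tubeSet Ot u v (10 * r₀) → G (refIdx m) x ≠ 1 := by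
    intro x hxcl hxN hx10 h1
    rw [hN, closure_union] at hxcl
    apply hxN
    rcases hxcl with hb | ho
    · -- frontier points of the box off `T(10 r₀)` with `σ = 0` are seam points, hence in `Out`
      obtain ⟨hxOt, hsq, hp, -⟩ := hclBox hb
      have hσ := hσ20 x (hCT20 x hxOt hsq)
      rw [h1, sub_self] at hσ
      have hq0 : qCo m (u x) (v x) = 0 := by
        rcases mul_eq_zero.1 hσ.symm with h | h
        · exact absurd h (by nlinarith)
        · exact h
      exact Or.inr (hback x ((hseam x hxOt).2 ⟨hq0, by linarith⟩) hx10)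
    · have hxV' : x ∈ V'fin := hclVfin (closure_mono (fun y hy => hy.1.1.2) ho)
      obtain ⟨y, -, hy⟩ := hmemV' x hxV'
      exact Or.inr (hback x ((hL6 y x hy).1 h1) hx10)
  refine ⟨N, η₀, hNo, hη₀, hP2, hP3, hP4, hP5, hP5n, hP6, hP7, hP8, hA1, hA2, hA3, ?_⟩
  -- ### the uniform no-critical-point estimate off `T(10 r₀)`
  intro ψ hψd hψ01 hψη x hxN hx10 f hf hfeq
  have hxOut : x ∈ Out := by
    rcases hxN with hb | ho
    · exact absurd hb.1 hx10
    · exact ho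
  obtain ⟨y, hyt, hy⟩ := hOutV' x hxOut
  exact hLM y ψ hψd hψ01 (fun s => (hψη s).trans (hη₀le y hyt)) x hy f hf hfeq

/-! ## The toolkit (a registered helper stub) -/

/-- **The seam-zone toolkit** (registered helper stub of the line, proved in this file): the
construction `exists_seamZone` of the seam zone `N m`. -/
def SeamFormZoneToolkit : Prop :=
  ∀ (X : Type) [TopologicalSpace X] [T2Space X] [ChartedSpace (EuclideanSpace ℝ (Fin 4)) X]
    [IsManifold (𝓡 4) ∞ X] [CompactSpace X]
    (S : Fin 3 → Set X) (u v : X → ℝ) (ρ : X → X) (U O : Set X) (c : Fin 3 → ℕ → ℕ),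
    TriNormalForm S 0 1 2 u v ρ U O c → ∀ (G : Fin 3 → X → ℝ),
    (∀ j, ContMDiff (𝓡 4) 𝓘(ℝ, ℝ) ∞ (G j)) →
    (∀ j, ∀ p ∈ S j, p ∉ interior (S j) → G j p = 1) →
    (∀ j, ∀ p ∈ interior (S j), G j p < 1) →
    (∀ j, ∀ p ∈ S j, p ∉ interior (S j) → p ∉ (⋂ l, S l) → ¬ IsMCriticalPt (𝓡 4) (G j) p) →
    (∀ j, ∀ p ∈ S j, p ∉ (⋂ l, S l) →
      ∃ D : HalfSliceChart (𝓡 4) (S j), p ∈ D.Θ.source ∧ ∀ q ∈ D.Θ.source, q ∉ ⋂ l, S l) →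
    ∀ (Ot : Set X) (rt : ℝ) (tp : X → ℝ → ℝ → X),
    TubeStructure (S 0) (⋂ l, S l) u v ρ O Ot rt tp → ∀ (r₀ : ℝ), 0 < r₀ → 20 * r₀ ≤ rt →
    (∀ j, ∀ x ∈ tubeSet Ot u v (20 * r₀), G j x = unitForm j (u x) (v x)) →
    ∀ (m : Fin 3) (Um : Set X), IsOpen Um →
    (∀ x ∈ S (refIdx m) ∩ S (normIdx m), x ∉ tubeSet Ot u v (9 * r₀) → x ∈ Um) →
    ∃ (N : Set X) (η : ℝ), IsOpen N ∧ 0 < η ∧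
      (∀ x ∈ S (refIdx m) ∩ S (normIdx m), x ∉ tubeSet Ot u v (2 * r₀) → x ∈ N) ∧
      (∀ x ∈ tubeSet Ot u v (10 * r₀),
        x ∈ N ↔ r₀ < pCo m (u x) (v x) ∧ |qCo m (u x) (v x)| < r₀ / 2) ∧
      N ⊆ tubeSet Ot u v (10 * r₀) ∪ Um ∧
      (∀ x ∈ N, ¬ IsMCriticalPt (𝓡 4) (G (refIdx m)) x) ∧
      (∀ x ∈ N, ¬ IsMCriticalPt (𝓡 4) (G (normIdx m)) x) ∧
      (∀ x ∈ N, G (refIdx m) x = 1 ↔ x ∈ S (refIdx m) ∩ S (normIdx m)) ∧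
      (∀ x ∈ N, x ∈ S (refIdx m) ↔ G (refIdx m) x ≤ 1) ∧
      (∀ x ∈ N, x ∈ S (normIdx m) ↔ 1 ≤ G (refIdx m) x) ∧
      (∀ x ∈ N, x ∈ closure (tubeSet Ot u v (10 * r₀)) →
        x ∈ Ot ∧ r₀ < pCo m (u x) (v x) ∧ |qCo m (u x) (v x)| < r₀ / 2) ∧
      (∀ x ∈ closure N, x ∉ N → x ∉ tubeSet Ot u v (10 * r₀) → G (refIdx m) x ≠ 1) ∧
      (∀ x ∈ closure N, x ∈ tubeSet Ot u v (10 * r₀) →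
        r₀ ≤ pCo m (u x) (v x) ∧ |qCo m (u x) (v x)| ≤ r₀ / 2) ∧
      (∀ ψ : ℝ → ℝ, Differentiable ℝ ψ → (∀ t, 0 ≤ ψ t ∧ ψ t ≤ 1) →
        (∀ t, |t * deriv ψ t| ≤ η) → ∀ x ∈ N, x ∉ tubeSet Ot u v (10 * r₀) → ∀ f : X → ℝ,
          ContMDiff (𝓡 4) 𝓘(ℝ, ℝ) ∞ f →
          (f =ᶠ[𝓝 x] fun w => G (normIdx m) w + ψ (G (refIdx m) w - 1) *
            (1 - (G (refIdx m) w - 1) - G (normIdx m) w)) →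
          ¬ IsMCriticalPt (𝓡 4) f x)

/-- **Registered helper stub `stub_seamFormZoneToolkit`** of line `lp-by-sphere-system-surgery`
(the seam zone of the seam normalisation `stub_seamForm`). [cite: AbramsGayKirby2018, proof of Thm. 5] -/
theorem stub_seamFormZoneToolkit : SeamFormZoneToolkit :=
  fun _ _ _ _ _ _ _ _ _ _ _ _ _ hT _ hGs hG1 hG2 hG3 hhalf _ _ _ hTS _ hr₀ hrt hunit m _ hUmo hUm =>
    exists_seamZone hT hGs hG1 hG2 hG3 hhalf hTS hr₀ hrt hunit m hUmo hUm

end Summit.SmoothPoincare4.SmoothPoincare4.Cruxes.AgkCor6Sufficiency.LpBySphereSystemSurgery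

end
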